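import Summits.RiemannHypothesis.RiemannHypothesis.Theorems.WeilGroundStateGroundStatesConvergeToXiEulerLagrange
import Summits.RiemannHypothesis.RiemannHypothesis.Theorems.WeilGroundStateGroundStatesConvergeToXiWeightedL1
import Literature.NumberTheory.LFunctions.WeilExplicit
import Literature.NumberTheory.LFunctions.WeilGroundState
import Literature.NumberTheory.LFunctions.WeilGroundStateRealZerosProofs
import Mathlib.Analysis.Calculus.IteratedDeriv.Lemmas
import HarnessLib

/-!
# The weak Euler–Lagrange equation AT the ground state (stub H4)
(crux item stmt-RiemannHypothesis-1527 `GroundStatesConvergeToXi`, route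
route-RiemannHypothesis-WeilGroundState, line `Sketch`; `--supports`, registered stub
`stub_groundState_eulerLagrange_strong` (H4))

The tree has Bombieri's variational equation (Bombieri 2000, §4 Lemma 1 / (4.2) `λ f = L[f]`)
in weak form ALONG THE MINIMISING SEQUENCE of an operator-free ground state `u` at window `a`
(`groundState_eulerLagrange`: `W(gₙ ⋆ h̃) → ε(a) ∫ u h̄`).  This file upgrades it to the ground
state ITSELF,

* `stub_groundState_eulerLagrange_strong` — `W(u ⋆ h̃) = ε(a) ∫ u h̄` for every window test
  function `h`,

taking as hypotheses (verbatim) the conclusions of the two neighbouring stubs of the line: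
(H2) dominated convergence of the Weil functional under a common `C e^{-b₀|t|}` envelope
(`b₀ > 1/2`) on `F, F', F''` plus pointwise convergence, and (H3(A)) smoothness and the
`iteratedDeriv` envelope `‖(f ⋆ h̃)^{(n)}(t)‖ ≤ C (∫‖f‖e^{b₁|u|}) e^{-b₀|t|}` of the convolution
of a weighted-`L¹` function with a reflected test function.

Proof: apply (H2) to `Fₙ = gₙ ⋆ h̃`, `G = u ⋆ h̃`, `b₀ = b₁ = 1`.  Smoothness and the common
envelope come from (H3(A)) at `n = 0, 1, 2` (`iteratedDeriv_one`, `iteratedDeriv_succ`) and the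
boundedness of the convergent sequence `∫‖gₙ‖e^{|t|} → ∫‖u‖e^{|t|}`
(`tendsto_integral_norm_mul_exp_of_minimizingSeq`, `Filter.Tendsto.bddAbove_range`); `G` is
continuous by (H3(A)) applied to `u` (weighted-`L¹` since `u ∈ L²` vanishes a.e. off the
window); pointwise convergence `(gₙ ⋆ h̃)(x) = ∫ gₙ(t) conj h(t − x) dt → (u ⋆ h̃)(x)` is an
`L²`-pairing with the translate `h(· − x)` (`ConnesVanSuijlekom.tendsto_integral_mul_conj_left`);
conclude by `tendsto_nhds_unique`.

References: E. Bombieri, Rend. Lincei (9) 11 (2000), §4 (Lemma 1, (4.2), Thm 3).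
-/

noncomputable section

set_option linter.dupNamespace false

open scoped Topology Real ComplexConjugate
open Filter Set MeasureTheory Complex

namespace Summit.RiemannHypothesis.RiemannHypothesis.Theorems.GroundStatesConvergeToXi

open Literature.NumberTheory.LFunctions

/-! ### Pointwise convergence of the polarised kernels -/

/-- **`(g ⋆ h̃)(x) = ⟨g, h(· − x)⟩`**: the polarised kernel at `x` is the `L²`-pairing of `g`
with the translate `h(· − x)` (`weilConv_apply`, `h̃(x − t) = conj h(t − x)`). [folklore] -/
theorem weilConv_weilReflect_apply_eq_integral_mul_conj (g h : ℝ → ℂ) (x : ℝ) :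
    weilConv g (weilReflect h) x = ∫ t, g t * conj (h (t - x)) := by
  rw [weilConv_apply]
  simp only [weilReflect, neg_sub]

/-- **Pointwise convergence of the polarised kernels along an `L²`-convergent sequence**: if
`gₙ → u` in `L²` (all in `L²`) and `h` is a test function, then `(gₙ ⋆ h̃)(x) → (u ⋆ h̃)(x)`
for every `x` (Cauchy–Schwarz against the translate `h(· − x) ∈ L²`). [folklore] -/
theorem tendsto_weilConv_weilReflect_apply {u : ℝ → ℂ} {g : ℕ → ℝ → ℂ}
    (hgm : ∀ n, MemLp (g n) 2) (hu : MemLp u 2)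
    (hL : Tendsto (fun n => ∫ t, ‖g n t - u t‖ ^ 2) atTop (𝓝 0))
    {h : ℝ → ℂ} (hh : IsWeilTest h) (x : ℝ) :
    Tendsto (fun n => weilConv (g n) (weilReflect h) x) atTop
      (𝓝 (weilConv u (weilReflect h) x)) := by
  have hhx : MemLp (fun t => h (t - x)) 2 :=
    ConnesVanSuijlekom.isWeilTest_memLp (hh.weilTranslate x)
  have key := ConnesVanSuijlekom.tendsto_integral_mul_conj_left hhx hu hgm hL
  simp only [weilConv_weilReflect_apply_eq_integral_mul_conj]
  exact key

/-! ### Weighted-`L¹` bookkeeping on the window -/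

/-- A window test function has `‖g‖ e^{b|t|}` integrable (continuous, compact support).
[folklore] -/
theorem integrable_norm_mul_exp_of_isWeilTest {g : ℝ → ℂ} (hg : IsWeilTest g) (b : ℝ) :
    Integrable (fun t : ℝ => ‖g t‖ * Real.exp (b * |t|)) :=
  ((hg.1.continuous.norm.mul (by fun_prop)).integrable_of_hasCompactSupport
    hg.2.norm.mul_right)

/-- A ground state has `‖u‖ e^{b|t|}` integrable (integrable on the compact window, a.e. zero
off it). [folklore] -/
theorem _root_.Literature.NumberTheory.LFunctions.IsWeilGroundState.integrable_norm_mul_exp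
    {a : ℝ} {u : ℝ → ℂ} (hu : IsWeilGroundState a u) (b : ℝ) :
    Integrable (fun t : ℝ => ‖u t‖ * Real.exp (b * |t|)) :=
  (IntegrableOn.mul_continuousOn hu.integrableOn.norm
    (by fun_prop : Continuous fun t : ℝ => Real.exp (b * |t|)).continuousOn
      isCompact_Icc).integrable_of_ae_notMem_eq_zero
        (hu.ae_eq_zero_of_notMem.mono fun t ht hts => by simp [ht hts])

/-! ### The stub -/

/-- **Stub H4 — the weak Euler–Lagrange equation at the ground state** (Bombieri 2000, §4
Lemma 1 / (4.2) `λ f = L[f]`, weak form, for the operator-free encoding `IsWeilGroundState`).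
Assume (H2) dominated convergence of the Weil functional: `W(Fₖ) → W(G)` whenever the smooth
`Fₖ → G` pointwise under a common envelope `‖Fₖ‖, ‖Fₖ'‖, ‖Fₖ''‖ ≤ C e^{-b₀|t|}`, `b₀ > 1/2`,
`G` continuous; and (H3(A)) the convolution envelope: `f ⋆ h̃` is smooth with
`‖(f ⋆ h̃)^{(n)}(t)‖ ≤ C (∫ ‖f‖ e^{b₁|u|}) e^{-b₀|t|}` for weighted-`L¹` `f` and test `h`.  Then
for every ground state `u` at window `a` and every test function `h` supported in `[-a, a]`,
`W(u ⋆ h̃) = ε(a) ∫ u h̄`.  Proof: along the minimising sequence `gₙ → u` of `u`,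
`W(gₙ ⋆ h̃) → ε(a) ∫ u h̄` (`groundState_eulerLagrange`) and `W(gₙ ⋆ h̃) → W(u ⋆ h̃)` by (H2)
with `b₀ = b₁ = 1`, the common envelope coming from (H3(A)) at `n ≤ 2` and
`sup ∫ ‖gₙ‖ e^{|t|} < ∞`, pointwise convergence from the `L²`-pairing with `h(· − x)`.
[cite: Bombieri2000, §4 (4.2)] -/
theorem stub_groundState_eulerLagrange_strong :
    (∀ (F : ℕ → ℝ → ℂ) (G : ℝ → ℂ) (C b₀ : ℝ), 1 / 2 < b₀ →
      (∀ k, ContDiff ℝ (⊤ : ℕ∞) (F k)) → Continuous G →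
      (∀ k t, ‖F k t‖ ≤ C * Real.exp (-(b₀ * |t|))) →
      (∀ k t, ‖deriv (F k) t‖ ≤ C * Real.exp (-(b₀ * |t|))) →
      (∀ k t, ‖deriv (deriv (F k)) t‖ ≤ C * Real.exp (-(b₀ * |t|))) →
      (∀ t, Tendsto (fun k => F k t) atTop (𝓝 (G t))) →
      Tendsto (fun k => weilFunctional (F k)) atTop (𝓝 (weilFunctional G))) →
    (∀ (h : ℝ → ℂ) (b₀ b₁ : ℝ), 0 ≤ b₀ → b₀ ≤ b₁ → IsWeilTest h → ∀ n : ℕ, ∃ C : ℝ, 0 ≤ C ∧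
      ∀ f : ℝ → ℂ, AEStronglyMeasurable f volume →
        Integrable (fun t : ℝ => ‖f t‖ * Real.exp (b₁ * |t|)) →
        ContDiff ℝ (⊤ : ℕ∞) (weilConv f (weilReflect h)) ∧
        ∀ t : ℝ, ‖iteratedDeriv n (weilConv f (weilReflect h)) t‖ ≤
          C * (∫ u, ‖f u‖ * Real.exp (b₁ * |u|)) * Real.exp (-(b₀ * |t|))) →
    ∀ (a : ℝ) (u : ℝ → ℂ), IsWeilGroundState a u → ∀ h : ℝ → ℂ, IsWeilTest h →
      tsupport h ⊆ Icc (-a) a →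
      weilFunctional (weilConv u (weilReflect h)) =
        (weilGroundEnergy a : ℂ) * ∫ t, u t * conj (h t) := by
  intro hDCT hEnv a u hu h hh hhs
  obtain ⟨hu2, g, hg, hQ, hL⟩ := id hu
  -- the weak equation along the minimising sequence
  have hEL := groundState_eulerLagrange hg hQ hu2 hL hh hhs
  -- notation
  set F : ℕ → ℝ → ℂ := fun n => weilConv (g n) (weilReflect h) with hF
  set G : ℝ → ℂ := weilConv u (weilReflect h) with hG
  -- (H3(A)) at `b₀ = b₁ = 1`, orders `0, 1, 2`
  have h01 : (0 : ℝ) ≤ 1 := zero_le_one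
  obtain ⟨C₀, hC₀, hE₀⟩ := hEnv h 1 1 h01 le_rfl hh 0
  obtain ⟨C₁, hC₁, hE₁⟩ := hEnv h 1 1 h01 le_rfl hh 1
  obtain ⟨C₂, hC₂, hE₂⟩ := hEnv h 1 1 h01 le_rfl hh 2
  -- weighted-`L¹` data of `gₙ` and `u`
  have hgm : ∀ n, MemLp (g n) 2 := fun n => ConnesVanSuijlekom.isWeilTest_memLp (hg n).1
  have hga : ∀ n, AEStronglyMeasurable (g n) volume := fun n => (hgm n).1
  have hgi : ∀ n, Integrable (fun t : ℝ => ‖g n t‖ * Real.exp (1 * |t|)) := fun n =>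
    integrable_norm_mul_exp_of_isWeilTest (hg n).1 1
  have hua : AEStronglyMeasurable u volume := hu2.1
  have hui : Integrable (fun t : ℝ => ‖u t‖ * Real.exp (1 * |t|)) :=
    hu.integrable_norm_mul_exp 1
  -- a uniform bound `∫ ‖gₙ‖ e^{|t|} ≤ B` (the sequence converges)
  obtain ⟨B, hB⟩ := (tendsto_integral_norm_mul_exp_of_minimizingSeq hu hg hL 1).bddAbove_range
  have hBn : ∀ n, (∫ t, ‖g n t‖ * Real.exp (1 * |t|)) ≤ B := fun n => hB ⟨n, rfl⟩
  have hB0 : 0 ≤ B := (integral_nonneg fun t => by positivity).trans (hBn 0)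
  -- the common constant
  set C : ℝ := max C₀ (max C₁ C₂) * B with hC
  have hdom : ∀ {C' : ℝ} (n : ℕ) (t : ℝ), 0 ≤ C' → C' ≤ max C₀ (max C₁ C₂) →
      C' * (∫ s, ‖g n s‖ * Real.exp (1 * |s|)) * Real.exp (-(1 * |t|)) ≤
        C * Real.exp (-(1 * |t|)) := by
    intro C' n t hC' hle
    refine mul_le_mul_of_nonneg_right ?_ (Real.exp_pos _).le
    exact mul_le_mul hle (hBn n) (integral_nonneg fun s => by positivity)
      (hC'.trans hle)
  -- smoothness and the three envelope bounds for `F n`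
  have hFs : ∀ k, ContDiff ℝ (⊤ : ℕ∞) (F k) := fun k => (hE₀ (g k) (hga k) (hgi k)).1
  have hF0 : ∀ k t, ‖F k t‖ ≤ C * Real.exp (-(1 * |t|)) := fun k t => by
    have h0 := (hE₀ (g k) (hga k) (hgi k)).2 t
    rw [iteratedDeriv_zero] at h0
    exact h0.trans (hdom k t hC₀ (le_max_left _ _))
  have hF1 : ∀ k t, ‖deriv (F k) t‖ ≤ C * Real.exp (-(1 * |t|)) := fun k t => by
    have h1 := (hE₁ (g k) (hga k) (hgi k)).2 t
    rw [iteratedDeriv_one] at h1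
    exact h1.trans (hdom k t hC₁ ((le_max_left _ _).trans (le_max_right _ _)))
  have hF2 : ∀ k t, ‖deriv (deriv (F k)) t‖ ≤ C * Real.exp (-(1 * |t|)) := fun k t => by
    have h2 := (hE₂ (g k) (hga k) (hgi k)).2 t
    rw [iteratedDeriv_succ, iteratedDeriv_one] at h2
    exact h2.trans (hdom k t hC₂ ((le_max_right _ _).trans (le_max_right _ _)))
  -- `G` is continuous (even smooth)
  have hGc : Continuous G := (hE₀ u hua hui).1.continuous
  -- pointwise convergence
  have hpt : ∀ t, Tendsto (fun k => F k t) atTop (𝓝 (G t)) := fun t =>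
    tendsto_weilConv_weilReflect_apply hgm hu2 hL hh t
  -- (H2): `W(F n) → W(G)`
  have hW : Tendsto (fun k => weilFunctional (F k)) atTop (𝓝 (weilFunctional G)) :=
    hDCT F G C 1 (by norm_num) hFs hGc hF0 hF1 hF2 hpt
  exact tendsto_nhds_unique hW hEL

/-- **Weak Euler–Lagrange equation at the ground state, `IsWeilGroundState` dot-notation form**
(curried corollary of `stub_groundState_eulerLagrange_strong`): under (H2) and (H3(A)),
`W(u ⋆ h̃) = ε(a) ∫ u h̄` for every window test function `h`. [cite: Bombieri2000, §4 (4.2)] -/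
theorem _root_.Literature.NumberTheory.LFunctions.IsWeilGroundState.weilFunctional_weilConv_weilReflect_eq
    {a : ℝ} {u : ℝ → ℂ} (hu : IsWeilGroundState a u)
    (hDCT : ∀ (F : ℕ → ℝ → ℂ) (G : ℝ → ℂ) (C b₀ : ℝ), 1 / 2 < b₀ →
      (∀ k, ContDiff ℝ (⊤ : ℕ∞) (F k)) → Continuous G →
      (∀ k t, ‖F k t‖ ≤ C * Real.exp (-(b₀ * |t|))) →
      (∀ k t, ‖deriv (F k) t‖ ≤ C * Real.exp (-(b₀ * |t|))) →
      (∀ k t, ‖deriv (deriv (F k)) t‖ ≤ C * Real.exp (-(b₀ * |t|))) →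
      (∀ t, Tendsto (fun k => F k t) atTop (𝓝 (G t))) →
      Tendsto (fun k => weilFunctional (F k)) atTop (𝓝 (weilFunctional G)))
    (hConv : ∀ (h : ℝ → ℂ) (b₀ b₁ : ℝ), 0 ≤ b₀ → b₀ ≤ b₁ → IsWeilTest h → ∀ n : ℕ, ∃ C : ℝ,
      0 ≤ C ∧ ∀ f : ℝ → ℂ, AEStronglyMeasurable f volume →
        Integrable (fun t : ℝ => ‖f t‖ * Real.exp (b₁ * |t|)) →
        ContDiff ℝ (⊤ : ℕ∞) (weilConv f (weilReflect h)) ∧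
        ∀ t : ℝ, ‖iteratedDeriv n (weilConv f (weilReflect h)) t‖ ≤
          C * (∫ u, ‖f u‖ * Real.exp (b₁ * |u|)) * Real.exp (-(b₀ * |t|)))
    {h : ℝ → ℂ} (hh : IsWeilTest h) (hhs : tsupport h ⊆ Icc (-a) a) :
    weilFunctional (weilConv u (weilReflect h)) =
      (weilGroundEnergy a : ℂ) * ∫ t, u t * conj (h t) :=
  stub_groundState_eulerLagrange_strong hDCT hConv a u hu h hh hhs

end Summit.RiemannHypothesis.RiemannHypothesis.Theorems.GroundStatesConvergeToXi

end
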